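import Literature.MathematicalPhysics.QuantumLattice.PeriodicSublatticeAndStaggeredTerms
import Literature.MathematicalPhysics.QuantumLattice.SuperlatticeCellEnergyFamilies
import HarnessLib

/-!
# Views of decorated models ARE single periodic interactions: `cellEnergy (views) = cellMeanEnergy (one interaction)`
# (re-centring covariance of the sublattice atoms; the bridge from the view calculus to the periodic T ≥ 0 theory)

Topic `Literature/MathematicalPhysics/QuantumLattice` (family `hubbard`; crew hubbard-fast S2 «families of models: multi-band by decoration»).
The tree describes a decorated-lattice model in TWO ways: (i) by its VIEWS `M : Cell q → FermionInteraction d` — the pattern as seen from each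
cell point — with the energy functional `cellEnergy M R ω = |C|⁻¹ Σ_n e_{M n}(ω ∘ τ_{pos n})` (`SuperlatticeCellEnergyFamilies`,
`SublatticeSelectiveInteractions`; the typed three-band object `emeryEnergyDensity` of `EmeryThreeBandByDecoration` and the router's Emery
boxes are stated in this language); (ii) as ONE superlattice-PERIODIC interaction `Ψ` with the energy functional
`cellMeanEnergy q Ψ R ω = |C|⁻¹ Σ_c Re ε(pos c)` (`PeriodicInteractionsCellEnergy`; the periodic pressure `P_q`, the periodic Gibbs
variational principle, the weighted open-cluster floors / caps `WeightedOpenClusterBoundsPeriodic` are stated in this language).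
This file proves that the two agree, atom by atom and along linear families, for EVERY state:

* §1 **re-centring covariance of the atoms**: `Φ_{c,v}(X + w) = Γ(τ_w)(Φ_{c−w,v} X)` (`sublatticeVectorHopping_apply_shiftSet`) and
  `Φ^{site}_{c}(X + w) = Γ(τ_w)(Φ^{site}_{c−w} X)` (`sublatticeOnSite_apply_shiftSet`) for EVERY lattice vector `w` (the coset label moves;
  for `w ∈ L_q` this is the periodicity of `PeriodicSublatticeAndStaggeredTerms`);
* §2 **the view through `n` is the site energy at `pos n`**: `(ω ∘ τ_{pos n})(E_{M n}) = ε_Ψ(pos n)` for the hopping and on-site atoms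
  (`expect_shift_meanEnergyObs_sublatticeVectorHoppingViews`, `…OnSiteViews`), hence
  **`cellEnergy (sublatticeVectorHoppingViews q c v t) R ω = cellMeanEnergy q (sublatticeVectorHopping q c v t) R ω`** and the on-site twin,
  for every state `ω`; constant views of a translation-covariant `Ψ` give `cellMeanEnergy q Ψ` (`cellEnergy_const_eq_cellMeanEnergy`);
* §3 **families**: if the base and every direction agree, the view family agrees with the linear family
  (`cellEnergy_viewFamily_eq_cellMeanEnergy_linearFamily`), so `infCellEnergyOn S (viewFamily …)` is the infimum of `cellMeanEnergy` of ONE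
  periodic interaction over `S` — every cluster floor on `cellMeanEnergy` over the class is a floor on the typed view-language object
  (`le_infCellEnergyOn_of_forall_cellMeanEnergy`).

Everything is PROVED; no definition, no named fact, no number.

## Mathlib / tree search

REUSED: `sublatticeVectorHopping(_apply_of_eq_pair/_apply_eq_zero)`, `sublatticeOnSite(_apply_of_eq_singleton/_apply_singleton/_apply_eq_zero)`,
`inCoset_sub_iff`, `sublatticeVectorHoppingViews`, `sublatticeOnSiteViews` (`SublatticeSelectiveInteractions`, `PeriodicSublatticeAndStaggeredTerms`);
`siteEnergy_eq_sum_shiftSet`, `cellMeanEnergy`, `cellMeanEnergy_eq_meanEnergy_cellAverage`, `cellMeanEnergy_linearFamily`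
(`PeriodicInteractionsCellEnergy`, `PeriodicVariationalEquilibria`); `cellEnergy`, `cellEnergy_const`, `cellEnergy_viewFamily`, `viewFamily`,
`le_infCellEnergyOn` (`SuperlatticeCellEnergyFamilies`); `KrausPattern.expect_meanEnergyObs`, `shift_expect`, `shiftSet_pair_eq`, `eq_pair_of_shiftSet_eq`,
`shiftSet_singleton_eq`, `eq_singleton_of_shiftSet_eq`, `fermionEmbed_shiftEmb_cAt`, `fermionEmbed_numberOp`, `PolySite.shiftEmb_pt`.
`lean search 'cellEnergy.*cellMeanEnergy|apply_shiftSet.*sublattice'` (2026-08-28): nothing.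

## References

* H. Araki, H. Moriya, Rev. Math. Phys. 15 (2003) 93, §4.1 (lattice translations, periodic states). [cite: ArakiMoriya2003, §4.1 Def. 4.5]
* E. Pavarini et al., Phys. Rev. Lett. 87 (2001) 047003, eq. (1) (decorated one-band / three-band dictionary). [cite: PavariniEtAl2001, eq. (1)]
* O. Bratteli, A. Kishimoto, D. W. Robinson, CMP 64 (1978) 41, §3 (mean energy functional). [cite: BratteliKishimotoRobinson1978, §3 (mean energy functional)]
-/

noncomputable section

open scoped ComplexOrder BigOperators
open Finset

namespace Literature.MathematicalPhysics.QuantumLattice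

open Matrix HubbardWave0 Literature.Probability.LatticeModels ThermodynamicLimit

variable {d : ℕ}

/-! ### §1 Re-centring covariance of the sublattice atoms -/

section Covariance

variable (q : Fin d → ℕ) (c : Site d) {v : Site d} (hv : v ≠ 0) (t : ℝ)
include hv

/-- **Re-centring covariance of the sublattice-selective hopping**: `Φ_{c,v}(X + w) = Γ(τ_w)(Φ_{c−w,v} X)` for every lattice vector `w`
(the start `x + w` lies in the coset of `c` iff `x` lies in the coset of `c − w`). [cite: ArakiMoriya2003, §4.1 Def. 4.5] -/
theorem sublatticeVectorHopping_apply_shiftSet (w : Site d) (X : Finset (Site d)) :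
    (sublatticeVectorHopping q c v t).Φ (shiftSet w X) =
      fermionEmbed (PolySite.shiftEmb w X) ((sublatticeVectorHopping q (c - w) v t).Φ X) := by
  by_cases h2 : ∃ x : Site d, X = {x, x + v}
  · obtain ⟨x, rfl⟩ := h2
    rw [sublatticeVectorHopping_apply_of_eq_pair q c hv t (shiftSet_pair_eq _ x (x + v)) (add_right_comm x v _)
        (PolySite.add_mem_shiftSet _ (mem_insert_self _ _))
        (PolySite.add_mem_shiftSet _ (mem_insert_of_mem (mem_singleton_self _))),
      sublatticeVectorHopping_apply_of_eq_pair q (c - w) hv t rfl rfl (mem_insert_self _ _)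
        (mem_insert_of_mem (mem_singleton_self _))]
    by_cases hx : InCoset q (c - w) x
    · rw [if_pos ((inCoset_sub_iff q c w x).1 hx), if_pos hx, map_smul, map_sum]
      simp only [map_add, map_mul, fermionEmbed_conjTranspose, fermionEmbed_shiftEmb_cAt]
    · rw [if_neg (fun h => hx ((inCoset_sub_iff q c w x).2 h)), if_neg hx, map_zero]
  have hX : (sublatticeVectorHopping q (c - w) v t).Φ X = 0 :=
    sublatticeVectorHopping_apply_eq_zero q (c - w) v t fun x hx => h2 ⟨x, hx⟩
  have hS : (sublatticeVectorHopping q c v t).Φ (shiftSet w X) = 0 := by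
    refine sublatticeVectorHopping_apply_eq_zero q c v t fun y hy => h2 ⟨y - w, ?_⟩
    rw [eq_pair_of_shiftSet_eq hy, add_sub_right_comm]
  rw [hX, hS, map_zero]

end Covariance

/-- **Re-centring covariance of the sublattice on-site term**: `Φ^{site}_c(X + w) = Γ(τ_w)(Φ^{site}_{c−w} X)` for every lattice vector `w`.
[cite: ArakiMoriya2003, §4.1 Def. 4.5] -/
theorem sublatticeOnSite_apply_shiftSet (q : Fin d → ℕ) (c : Site d) (ε U : ℝ) (w : Site d) (X : Finset (Site d)) :
    (sublatticeOnSite q c ε U).Φ (shiftSet w X) = fermionEmbed (PolySite.shiftEmb w X) ((sublatticeOnSite q (c - w) ε U).Φ X) := by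
  by_cases h1 : ∃ x : Site d, X = {x}
  · obtain ⟨x, rfl⟩ := h1
    rw [sublatticeOnSite_apply_of_eq_singleton q c ε U (shiftSet_singleton_eq _ x) (PolySite.add_mem_shiftSet _ (mem_singleton_self x)),
      sublatticeOnSite_apply_singleton]
    by_cases hx : InCoset q (c - w) x
    · rw [if_pos ((inCoset_sub_iff q c w x).1 hx), if_pos hx]
      simp only [map_add, map_smul, map_mul, nAt, fermionEmbed_numberOp, PolySite.shiftEmb_pt]
    · rw [if_neg (fun h => hx ((inCoset_sub_iff q c w x).2 h)), if_neg hx, map_zero]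
  have hX : (sublatticeOnSite q (c - w) ε U).Φ X = 0 := sublatticeOnSite_apply_eq_zero q (c - w) ε U fun x hx => h1 ⟨x, hx⟩
  have hS : (sublatticeOnSite q c ε U).Φ (shiftSet w X) = 0 :=
    sublatticeOnSite_apply_eq_zero q c ε U fun y hy => h1 ⟨y - w, eq_singleton_of_shiftSet_eq hy⟩
  rw [hX, hS, map_zero]

/-! ### §2 The view through a cell point is the site energy at that point -/

namespace InfVolFermionState

variable {q : Fin d → ℕ}

/-- **A re-centred interaction seen in the translated state is the site energy**: if `Ψ'(X) ↦ Ψ(X + x)` covariantly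
(`Ψ.Φ (X + x) = Γ(τ_x)(Ψ'.Φ X)` for all `X`), then `(ω ∘ τ_x)(E_{Ψ'}) = ε_Ψ(x)` for every state `ω`.
[cite: BratteliKishimotoRobinson1978, §3 (mean energy functional)] -/
theorem expect_shift_meanEnergyObs_eq_siteEnergy_of_covariant {Ψ Ψ' : FermionInteraction d} {x : Site d}
    (h : ∀ X : Finset (Site d), Ψ.Φ (shiftSet x X) = fermionEmbed (PolySite.shiftEmb x X) (Ψ'.Φ X)) (ω : InfVolFermionState d) (R : ℝ) :
    (ω.shift x).expect _ (Ψ'.meanEnergyObs R) = siteEnergy Ψ ω R x := by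
  rw [KrausPattern.expect_meanEnergyObs, siteEnergy_eq_sum_shiftSet]
  refine Finset.sum_congr rfl fun X _ => ?_
  rw [card_shiftSet, shift_expect, h X]

/-- **Hopping views**: `(ω ∘ τ_{pos n})(E_{view n}) = ε_{Φ_{c,v}}(pos n)` for every state and every cell point. [cite: ArakiMoriya2003, §4.1 Def. 4.5] -/
theorem expect_shift_meanEnergyObs_sublatticeVectorHoppingViews (c : Site d) {v : Site d} (hv : v ≠ 0) (t : ℝ)
    (ω : InfVolFermionState d) (R : ℝ) (n : Cell q) :
    (ω.shift (cellPos n)).expect _ ((sublatticeVectorHoppingViews q c v t n).meanEnergyObs R) =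
      siteEnergy (sublatticeVectorHopping q c v t) ω R (cellPos n) :=
  expect_shift_meanEnergyObs_eq_siteEnergy_of_covariant (fun X => sublatticeVectorHopping_apply_shiftSet q c hv t (cellPos n) X) ω R

/-- **On-site views**: `(ω ∘ τ_{pos n})(E_{view n}) = ε_{Φ^{site}_c}(pos n)`. [cite: ArakiMoriya2003, §4.1 Def. 4.5] -/
theorem expect_shift_meanEnergyObs_sublatticeOnSiteViews (c : Site d) (ε U : ℝ) (ω : InfVolFermionState d) (R : ℝ) (n : Cell q) :
    (ω.shift (cellPos n)).expect _ ((sublatticeOnSiteViews q c ε U n).meanEnergyObs R) =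
      siteEnergy (sublatticeOnSite q c ε U) ω R (cellPos n) :=
  expect_shift_meanEnergyObs_eq_siteEnergy_of_covariant (fun X => sublatticeOnSite_apply_shiftSet q c ε U (cellPos n) X) ω R

/-- **THE BRIDGE FOR HOPPING ATOMS**: the cell energy of the views is the cell energy density of the single periodic interaction,
for EVERY state. [cite: ArakiMoriya2003, §4.1 Def. 4.5] [cite: PavariniEtAl2001, eq. (1)] -/
theorem cellEnergy_sublatticeVectorHoppingViews_eq_cellMeanEnergy (c : Site d) {v : Site d} (hv : v ≠ 0) (t : ℝ) (R : ℝ)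
    (ω : InfVolFermionState d) :
    ω.cellEnergy (sublatticeVectorHoppingViews q c v t) R = cellMeanEnergy q (sublatticeVectorHopping q c v t) ω R := by
  rw [InfVolFermionState.cellEnergy, cellMeanEnergy]
  congr 1
  refine Finset.sum_congr rfl fun n _ => ?_
  rw [InfVolFermionState.meanEnergy, expect_shift_meanEnergyObs_sublatticeVectorHoppingViews c hv t ω R n]

/-- **THE BRIDGE FOR ON-SITE ATOMS.** [cite: ArakiMoriya2003, §4.1 Def. 4.5] [cite: PavariniEtAl2001, eq. (1)] -/
theorem cellEnergy_sublatticeOnSiteViews_eq_cellMeanEnergy (c : Site d) (ε U : ℝ) (R : ℝ) (ω : InfVolFermionState d) :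
    ω.cellEnergy (sublatticeOnSiteViews q c ε U) R = cellMeanEnergy q (sublatticeOnSite q c ε U) ω R := by
  rw [InfVolFermionState.cellEnergy, cellMeanEnergy]
  congr 1
  refine Finset.sum_congr rfl fun n _ => ?_
  rw [InfVolFermionState.meanEnergy, expect_shift_meanEnergyObs_sublatticeOnSiteViews c ε U ω R n]

/-- **Constant views of a translation-covariant interaction** have cell energy `cellMeanEnergy q Ψ` (both are the mean energy of the cell
average). [cite: BratteliKishimotoRobinson1978, §3 (mean energy functional)] -/
theorem cellEnergy_const_eq_cellMeanEnergy {Ψ : FermionInteraction d} (hT : Ψ.IsTranslationInvariant) (R : ℝ) (ω : InfVolFermionState d) :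
    ω.cellEnergy (fun _ : Cell q => Ψ) R = cellMeanEnergy q Ψ ω R := by
  rw [ω.cellEnergy_const, cellMeanEnergy_eq_meanEnergy_cellAverage hT]

/-! ### §3 View families versus linear families -/

/-- **FAMILIES**: if the base views agree with `Ψ₀` and every direction's views agree with `Ψ_a` (as functionals on the state `ω`), the view
family agrees with the linear family: `cellEnergy (viewFamily M₀ D θ) R ω = cellMeanEnergy q (Ψ₀ + Σ θ_a Ψ_a) R ω`.
[cite: KomaTasaki1994, §1] -/
theorem cellEnergy_viewFamily_eq_cellMeanEnergy_linearFamily {ι : Type*} [Fintype ι] {M₀ : Cell q → FermionInteraction d}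
    {D : ι → Cell q → FermionInteraction d} {Ψ₀ : FermionInteraction d} {Ψv : ι → FermionInteraction d} {R : ℝ} {ω : InfVolFermionState d}
    (h₀ : ω.cellEnergy M₀ R = cellMeanEnergy q Ψ₀ ω R) (hD : ∀ a, ω.cellEnergy (D a) R = cellMeanEnergy q (Ψv a) ω R) (θ : ι → ℝ) :
    ω.cellEnergy (viewFamily M₀ D θ) R = cellMeanEnergy q (FermionInteraction.linearFamily Ψ₀ Ψv θ) ω R := by
  rw [ω.cellEnergy_viewFamily, cellMeanEnergy_linearFamily, h₀]
  simp_rw [hD]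

/-- **Cluster floors on the single interaction are floors on the view-language object**: if the two functionals agree on every state of a
nonempty class `S` and `m ≤ cellMeanEnergy q Ψ R ω` for every `ω ∈ S`, then `m ≤ infCellEnergyOn S M R`.
[cite: BratteliKishimotoRobinson1978, Thm. 2 (condition 2)] -/
theorem le_infCellEnergyOn_of_forall_cellMeanEnergy {S : Set (InfVolFermionState d)} (hS : S.Nonempty) {M : Cell q → FermionInteraction d}
    {Ψ : FermionInteraction d} {R : ℝ} (heq : ∀ ω ∈ S, InfVolFermionState.cellEnergy M R ω = cellMeanEnergy q Ψ ω R) {m : ℝ}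
    (hm : ∀ ω ∈ S, m ≤ cellMeanEnergy q Ψ ω R) : m ≤ infCellEnergyOn S M R :=
  le_infCellEnergyOn M R hS fun ω hω => by rw [heq ω hω]; exact hm ω hω

end InfVolFermionState

end Literature.MathematicalPhysics.QuantumLattice

end
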